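import Literature.Barriers.CriticalPhenomena.LaceExpansionHaraLemma41Cube
import Literature.Barriers.CriticalPhenomena.LaceExpansionXSpaceNormsFejer
import Mathlib.MeasureTheory.Integral.IntervalIntegral.Periodic
import HarnessLib

/-!
# Fractional weights by dyadic second differences and their Fourier representatives
# (towards Hara 2008, Lemma 1.7 with non-integer exponents)

Support file for the analytic named fact `Hara2008_lemma17Pc` (`LaceExpansionXSpaceNorms.lean`).
Hara (§4.1.3–§4.1.4, §4.3–§4.4) treats the weights `|x_j|^{n-ε}` through fractional derivatives
(the kernels `L_{o,ε}, L_{e,ε}` of (4.28), residue calculus, Props. 4.3–4.5). Here the same goal —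
an honest Fourier representative of `|x_j|^θ`-weighted lattice functions together with `L^p` bounds —
is reached by FINITE DIFFERENCES: the weight

  `w_θ(t) = Σ_{n ≥ 0} 2^{nθ} (1 - cos(π t / 2^n))`      (`0 < θ < 2`)

is comparable with `|t|^θ` on `ℤ ∖ {0}` (`fracWeight`, `fracWeight_ge`), and if
`f(x) = ∫_{[-π,π]^d} e^{ik·x} F(k) dk/(2π)^d` with `F` `2π`-periodic in `k_j`, then
`w_θ(x_j) f(x) = ∫ e^{ik·x} (T_θ F)(k) dk/(2π)^d` with the dyadic second-difference smear
`T_θ F = Σ_n 2^{nθ} (F - ½ F(· + h_n e_j) - ½ F(· - h_n e_j))`, `h_n = π/2^n`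
(`IsFourierPair.fracWeight_mul`), because a shift of `F` by `h e_j` multiplies the Fourier
coefficient by `e^{-ihx_j}` (`setIntegral_cube_cexp_mul_shift`). All [folklore].

## References

* T. Hara, Ann. Probab. 36 (2008) 530–593 (arXiv:math-ph/0504021): §4.1.3, §4.3 ("One way to prove
  that a given function `f(x)` decays at least as fast as `|x|^{-n}` … suitably defined
  `(n-ε)`th-derivative", (4.28)–(4.30)).
-/

noncomputable section

namespace Literature.Barriers.CriticalPhenomena

open _root_.MeasureTheory _root_.Filter _root_.Topology Finset Literature.Probability.LatticeModels
  Literature.Probability.Percolation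

open scoped ENNReal NNReal

namespace FracSmear

/-! ### Integrals of `2π`-periodic functions over a period do not see shifts -/

/-- For a `2π`-periodic `φ : ℝ → E`, `∫_{[-π,π]} φ(s + h) ds = ∫_{[-π,π]} φ(s) ds`. [folklore] -/
theorem setIntegral_Icc_comp_add_of_periodic {E : Type*} [NormedAddCommGroup E] [NormedSpace ℝ E]
    {φ : ℝ → E} (hφ : Function.Periodic φ (2 * Real.pi)) (h : ℝ) :
    ∫ s in Set.Icc (-Real.pi) Real.pi, φ (s + h) = ∫ s in Set.Icc (-Real.pi) Real.pi, φ s := by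
  have hπ : -Real.pi ≤ Real.pi := by linarith [Real.pi_pos]
  rw [integral_Icc_eq_integral_Ioc, integral_Icc_eq_integral_Ioc, ← intervalIntegral.integral_of_le hπ,
    ← intervalIntegral.integral_of_le hπ, intervalIntegral.integral_comp_add_right]
  have h1 := hφ.intervalIntegral_add_eq (-Real.pi + h) (-Real.pi)
  rw [show -Real.pi + h + 2 * Real.pi = Real.pi + h by ring,
    show -Real.pi + 2 * Real.pi = Real.pi by ring] at h1
  exact h1

/-- For a `2π`-periodic `φ : ℝ → [0,∞]`, `∫⁻_{[-π,π]} φ(s + h) ds = ∫⁻_{[-π,π]} φ(s) ds`.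
[folklore] -/
theorem setLIntegral_Icc_comp_add_of_periodic {φ : ℝ → ℝ≥0∞}
    (hφ : Function.Periodic φ (2 * Real.pi)) (h : ℝ) :
    ∫⁻ s in Set.Icc (-Real.pi) Real.pi, φ (s + h) = ∫⁻ s in Set.Icc (-Real.pi) Real.pi, φ s := by
  have hT : 0 < 2 * Real.pi := Real.two_pi_pos
  -- translate: `∫⁻_{Icc (-π) π} φ(s+h) = ∫⁻_{Icc (-π+h) (π+h)} φ`
  have h1 : ∫⁻ s in Set.Icc (-Real.pi) Real.pi, φ (s + h) =
      ∫⁻ s in Set.Icc (-Real.pi + h) (Real.pi + h), φ s := by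
    rw [(measurePreserving_add_right volume h).setLIntegral_comp_emb (measurableEmbedding_addRight h),
      Set.image_add_const_Icc]
  rw [h1, ← setLIntegral_congr Ioc_ae_eq_Icc, ← setLIntegral_congr Ioc_ae_eq_Icc]
  -- both `Ioc` are fundamental domains for `2πℤ`
  haveI : VAddInvariantMeasure (AddSubgroup.zmultiples (2 * Real.pi)) ℝ volume :=
    ⟨fun c s _ => measure_preimage_add _ _ _⟩
  have hA := isAddFundamentalDomain_Ioc hT (-Real.pi + h)
  have hB := isAddFundamentalDomain_Ioc hT (-Real.pi)
  rw [show -Real.pi + h + 2 * Real.pi = Real.pi + h by ring] at hA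
  rw [show -Real.pi + 2 * Real.pi = Real.pi by ring] at hB
  exact hA.setLIntegral_eq hB φ (hφ.map_vadd_zmultiples)

/-! ### The dyadic fractional weight -/

/-- The dyadic steps `h_n = π / 2^{n+2}` (all at most `π/4`, so that shifts by `±h_n` of points of
`[-π,π]^d` near the origin stay in the cube). [folklore] -/
def step (n : ℕ) : ℝ := Real.pi / 2 ^ (n + 2)

/-- `h_n > 0`. [folklore] -/
theorem step_pos (n : ℕ) : 0 < step n := div_pos Real.pi_pos (pow_pos two_pos _)

/-- `h_n ≤ π/4`. [folklore] -/
theorem step_le (n : ℕ) : step n ≤ Real.pi / 4 := by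
  rw [step, pow_add]
  exact div_le_div_of_nonneg_left Real.pi_pos.le (by norm_num)
    (by nlinarith [one_le_pow₀ (M₀ := ℝ) (a := 2) (n := n) (by norm_num)])

/-- `h_n ≤ π`. [folklore] -/
theorem step_le_pi (n : ℕ) : step n ≤ Real.pi := (step_le n).trans (by linarith [Real.pi_pos])

/-- `h_n = (π/4) (1/2)^n`. [folklore] -/
theorem step_eq (n : ℕ) : step n = Real.pi / 4 * (1 / 2) ^ n := by
  simp only [step, one_div, inv_pow, pow_add]; ring

/-- The `n`-th term `2^{nθ} (1 - cos(h_n t))` of the weight. [folklore] -/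
def term (θ : ℝ) (n : ℕ) (t : ℝ) : ℝ := (2 : ℝ) ^ ((n : ℝ) * θ) * (1 - Real.cos (step n * t))

/-- The terms of the weight are nonnegative. [folklore] -/
theorem term_nonneg (θ : ℝ) (n : ℕ) (t : ℝ) : 0 ≤ term θ n t :=
  mul_nonneg (Real.rpow_nonneg (by norm_num) _) (sub_nonneg.2 (Real.cos_le_one _))

/-- `2^{nθ} (1 - cos(h_n t)) ≤ (π² t²/32) · (2^{θ-2})^n`. [folklore] -/
theorem term_le (θ : ℝ) (n : ℕ) (t : ℝ) :
    term θ n t ≤ Real.pi ^ 2 * t ^ 2 / 32 * ((2 : ℝ) ^ (θ - 2)) ^ n := by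
  have hcos : 1 - Real.cos (step n * t) ≤ (step n * t) ^ 2 / 2 := by
    linarith [Real.one_sub_sq_div_two_le_cos (x := step n * t)]
  have key : ((2 : ℝ) ^ (θ - 2)) ^ n * ((2 : ℝ) ^ n) ^ 2 = (2 : ℝ) ^ ((n : ℝ) * θ) := by
    rw [← Real.rpow_natCast ((2 : ℝ) ^ (θ - 2)) n, ← Real.rpow_mul (by norm_num), ← pow_mul,
      ← Real.rpow_natCast 2 (n * 2), ← Real.rpow_add two_pos]
    congr 1
    push_cast
    ring
  have h2n : (0 : ℝ) < 2 ^ n := pow_pos two_pos n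
  have h2 : (2 : ℝ) ^ ((n : ℝ) * θ) * ((step n * t) ^ 2 / 2) =
      Real.pi ^ 2 * t ^ 2 / 32 * ((2 : ℝ) ^ (θ - 2)) ^ n := by
    rw [← key, step, pow_add]
    field_simp
    ring
  calc term θ n t ≤ (2 : ℝ) ^ ((n : ℝ) * θ) * ((step n * t) ^ 2 / 2) :=
        mul_le_mul_of_nonneg_left hcos (Real.rpow_nonneg (by norm_num) _)
    _ = _ := h2

/-- `2^{θ-2} < 1` for `θ < 2`. [folklore] -/
theorem two_rpow_sub_two_lt_one {θ : ℝ} (hθ : θ < 2) : (2 : ℝ) ^ (θ - 2) < 1 :=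
  Real.rpow_lt_one_of_one_lt_of_neg (by norm_num) (by linarith)

/-- `2^{θ-2} ≥ 0`. [folklore] -/
theorem two_rpow_sub_two_nonneg (θ : ℝ) : 0 ≤ (2 : ℝ) ^ (θ - 2) := Real.rpow_nonneg (by norm_num) _

/-- The series `Σ_n 2^{nθ}(1 - cos(h_n t))` converges for `θ < 2`. [folklore] -/
theorem summable_term {θ : ℝ} (hθ : θ < 2) (t : ℝ) : Summable fun n => term θ n t := by
  refine Summable.of_nonneg_of_le (fun n => term_nonneg θ n t) (fun n => term_le θ n t) ?_
  exact (summable_geometric_of_lt_one (two_rpow_sub_two_nonneg θ) (two_rpow_sub_two_lt_one hθ)).mul_left _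

/-- **The dyadic fractional weight** `w_θ(t) = Σ_{n ≥ 0} 2^{nθ} (1 - cos(π t/2^n))`, a substitute for
`|t|^θ` (`0 < θ < 2`) whose Fourier side is a series of second differences. [folklore] -/
def fracWeight (θ : ℝ) (t : ℝ) : ℝ := ∑' n : ℕ, term θ n t

/-- `w_θ ≥ 0`. [folklore] -/
theorem fracWeight_nonneg (θ t : ℝ) : 0 ≤ fracWeight θ t := tsum_nonneg fun n => term_nonneg θ n t

/-- `w_θ(0) = 0`. [folklore] -/
@[simp] theorem fracWeight_zero (θ : ℝ) : fracWeight θ 0 = 0 := by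
  simp [fracWeight, term]

/-- The defining series sums to `w_θ(t)` (`θ < 2`). [folklore] -/
theorem hasSum_fracWeight {θ : ℝ} (hθ : θ < 2) (t : ℝ) :
    HasSum (fun n => term θ n t) (fracWeight θ t) := (summable_term hθ t).hasSum

/-- `1 - cos (1/2) > 0`. [folklore] -/
theorem one_sub_cos_half_pos : 0 < 1 - Real.cos (1 / 2) := by
  have h : Real.cos (1 / 2) < 1 := by
    have := Real.cos_lt_cos_of_nonneg_of_le_pi_div_two le_rfl (by linarith [Real.pi_gt_three])
      (by norm_num : (0 : ℝ) < 1 / 2)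
    rwa [Real.cos_zero] at this
  linarith

/-- `cos u ≤ cos (1/2)` for `u ∈ [1/2, 2]`. [folklore] -/
theorem cos_le_cos_half {u : ℝ} (hu1 : 1 / 2 ≤ u) (hu2 : u ≤ 2) : Real.cos u ≤ Real.cos (1 / 2) :=
  Real.cos_le_cos_of_nonneg_of_le_pi (by norm_num) (by linarith [Real.pi_gt_three]) hu1

/-- **Lower comparison with `|t|^θ`**: for `|t| ≥ 1` and `θ ≥ 0`,
`(1 - cos ½) (π|t|/8)^θ ≤ w_θ(t)` (a single dyadic term: the one with `h_n |t| ∈ [½, 2)`). [folklore] -/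
theorem fracWeight_ge {θ : ℝ} (hθ0 : 0 ≤ θ) (hθ : θ < 2) {t : ℝ} (ht : 1 ≤ |t|) :
    (1 - Real.cos (1 / 2)) * (Real.pi * |t| / 8) ^ θ ≤ fracWeight θ t := by
  -- `x = h_0 |t| = π|t|/4 ≥ π/4 > 1/2`
  set x : ℝ := Real.pi * |t| / 4 with hx
  have hx1 : 1 / 2 < x := by rw [hx]; nlinarith [Real.pi_gt_three]
  have hstep : ∀ n : ℕ, step n * |t| = x / 2 ^ n := by
    intro n; rw [hx, step, pow_add]; field_simp; ring
  have hcosabs : ∀ n : ℕ, Real.cos (step n * t) = Real.cos (step n * |t|) := by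
    intro n
    rcases le_or_gt 0 t with h0 | h0
    · rw [abs_of_nonneg h0]
    · rw [abs_of_neg h0, mul_neg, Real.cos_neg]
  -- choose the dyadic index
  obtain ⟨n, hn1, hn2⟩ : ∃ n : ℕ, 1 / 2 ≤ x / 2 ^ n ∧ x / 2 ^ n ≤ 2 ∧ (x / 2) ^ θ ≤ (2 : ℝ) ^ ((n : ℝ) * θ) := by
    rcases lt_or_ge x 1 with hx' | hx'
    · refine ⟨0, ?_, ?_, ?_⟩
      · simp; linarith
      · simp; linarith
      · simp only [Nat.cast_zero, zero_mul, Real.rpow_zero]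
        exact Real.rpow_le_one (by linarith) (by linarith) hθ0
    · obtain ⟨n, hn, hn1⟩ := exists_nat_pow_near hx' one_lt_two
      have h2n : (0 : ℝ) < 2 ^ n := pow_pos two_pos n
      refine ⟨n, ?_, ?_, ?_⟩
      · rw [le_div_iff₀ h2n]; linarith
      · rw [div_le_iff₀ h2n, pow_succ] at *; linarith
      · rw [Real.rpow_mul (by norm_num), Real.rpow_natCast]
        refine Real.rpow_le_rpow (by linarith) ?_ hθ0
        rw [div_le_iff₀ two_pos, ← pow_succ]; exact hn1.le
  obtain ⟨hn2, hn3⟩ := hn2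
  have hle : term θ n t ≤ fracWeight θ t :=
    (summable_term hθ t).le_tsum n (fun m _ => term_nonneg θ m t)
  refine le_trans ?_ hle
  rw [term, hcosabs n, hstep n]
  have hcos : 1 - Real.cos (1 / 2) ≤ 1 - Real.cos (x / 2 ^ n) := by
    linarith [cos_le_cos_half hn1 hn2]
  have hx8 : Real.pi * |t| / 8 = x / 2 := by rw [hx]; ring
  rw [hx8]
  calc (1 - Real.cos (1 / 2)) * (x / 2) ^ θ
      ≤ (1 - Real.cos (x / 2 ^ n)) * (2 : ℝ) ^ ((n : ℝ) * θ) :=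
        mul_le_mul hcos hn3 (by positivity) (sub_nonneg.2 (Real.cos_le_one _))
    _ = (2 : ℝ) ^ ((n : ℝ) * θ) * (1 - Real.cos (x / 2 ^ n)) := mul_comm _ _

/-- **`c_θ |t|^θ ≤ w_θ(t)` on `ℤ`** (`0 < θ < 2`) with `c_θ = (1 - cos ½)(π/8)^θ > 0` (at `t = 0` both
sides vanish). [folklore] -/
theorem mul_abs_rpow_le_fracWeight {θ : ℝ} (hθ0 : 0 < θ) (hθ : θ < 2) (t : ℤ) :
    (1 - Real.cos (1 / 2)) * (Real.pi / 8) ^ θ * |(t : ℝ)| ^ θ ≤ fracWeight θ t := by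
  rcases eq_or_ne t 0 with rfl | ht
  · simp [Real.zero_rpow hθ0.ne']
  · have ht1 : 1 ≤ |(t : ℝ)| := by
      rw [← Int.cast_abs]; exact_mod_cast Int.one_le_abs ht
    have h := fracWeight_ge hθ0.le hθ ht1
    rw [show Real.pi * |(t : ℝ)| / 8 = Real.pi / 8 * |(t : ℝ)| by ring,
      Real.mul_rpow (by positivity) (abs_nonneg _), ← mul_assoc] at h
    exact h

/-- The comparison constant `c_θ = (1 - cos ½)(π/8)^θ` is positive. [folklore] -/
theorem fracWeight_const_pos {θ : ℝ} : 0 < (1 - Real.cos (1 / 2)) * (Real.pi / 8) ^ θ :=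
  mul_pos one_sub_cos_half_pos (Real.rpow_pos_of_pos (by positivity) θ)

/-! ### Integrability of series with summable `L¹` norms -/

/-- A series of a.e.-strongly measurable functions with `Σ_n ∫ ‖g_n‖ < ∞` sums to an integrable
function, and `∫ ‖Σ_n g_n‖ ≤ Σ_n ∫ ‖g_n‖` (in `[0,∞]`). [folklore] -/
theorem integrable_tsum_of_lintegral {α : Type*} [MeasurableSpace α] {μ : Measure α}
    {g : ℕ → α → ℂ} (hg : ∀ n, AEStronglyMeasurable (g n) μ)
    (h : ∑' n, ∫⁻ a, ‖g n a‖ₑ ∂μ ≠ ⊤) :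
    Integrable (fun a => ∑' n, g n a) μ ∧
      ∫⁻ a, ‖∑' n, g n a‖ₑ ∂μ ≤ ∑' n, ∫⁻ a, ‖g n a‖ₑ ∂μ := by
  have hS : ∀ᵐ a ∂μ, Summable fun n => ‖g n a‖ := by
    refine summable_norm_of_tsum_eLpNorm_ne_top le_rfl hg ?_
    simpa only [eLpNorm_one_eq_lintegral_enorm] using h
  have hmeas : AEStronglyMeasurable (fun a => ∑' n, g n a) μ := by
    refine aestronglyMeasurable_of_tendsto_ae atTop
      (f := fun N a => ∑ n ∈ Finset.range N, g n a) (fun N => ?_) ?_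
    · exact Finset.aestronglyMeasurable_fun_sum _ fun n _ => hg n
    · filter_upwards [hS] with a ha using ha.of_norm.hasSum.tendsto_sum_nat
  have hle : ∫⁻ a, ‖∑' n, g n a‖ₑ ∂μ ≤ ∑' n, ∫⁻ a, ‖g n a‖ₑ ∂μ := by
    calc ∫⁻ a, ‖∑' n, g n a‖ₑ ∂μ ≤ ∫⁻ a, ∑' n, ‖g n a‖ₑ ∂μ :=
          lintegral_mono fun a => enorm_tsum_le_tsum_enorm
      _ = ∑' n, ∫⁻ a, ‖g n a‖ₑ ∂μ := lintegral_tsum fun n => (hg n).enorm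
  exact ⟨⟨hmeas, lt_of_le_of_lt hle h.lt_top⟩, hle⟩

/-! ### Shifts in one coordinate and periodicity -/

variable {n : ℕ}

/-- The shift `k ↦ k + h e_l`. [folklore] -/
def shift (l : Fin (n + 1)) (h : ℝ) (k : Fin (n + 1) → ℝ) : Fin (n + 1) → ℝ :=
  Function.update k l (k l + h)

/-- On a slice, the shift moves the slice variable: `ins_l(s,k') + h e_l = ins_l(s + h, k')`. [folklore] -/
theorem shift_insertNth (l : Fin (n + 1)) (h s : ℝ) (k' : Fin n → ℝ) :
    shift l h (l.insertNth s k') = l.insertNth (s + h) k' := by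
  simp only [shift, Fin.insertNth_apply_same, update_insertNth_eq]

/-- The shift by `0` is the identity. [folklore] -/
theorem shift_zero (l : Fin (n + 1)) (k : Fin (n + 1) → ℝ) : shift l 0 k = k := by
  simp [shift]

/-- `(k + h e_l)·x = k·x + h x_l`. [folklore] -/
theorem kdot_shift (l : Fin (n + 1)) (h : ℝ) (k : Fin (n + 1) → ℝ) (x : Site (n + 1)) :
    kdot (shift l h k) x = kdot k x + h * ((x l : ℤ) : ℝ) := by
  rw [shift, kdot_update]; ring

/-- The shift is continuous. [folklore] -/
theorem continuous_shift (l : Fin (n + 1)) (h : ℝ) : Continuous (shift l h) := by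
  unfold shift
  fun_prop

/-- The shift is measurable. [folklore] -/
theorem measurable_shift (l : Fin (n + 1)) (h : ℝ) : Measurable (shift l h) :=
  (continuous_shift l h).measurable

/-- `F` is `2π`-periodic in the coordinate `l`. [folklore] -/
def IsPeriodicIn (l : Fin (n + 1)) {E : Type*} (F : (Fin (n + 1) → ℝ) → E) : Prop :=
  ∀ k, F (Function.update k l (k l + 2 * Real.pi)) = F k

/-- A coordinate-periodic function has `2π`-periodic slices. [folklore] -/
theorem IsPeriodicIn.slice {E : Type*} {F : (Fin (n + 1) → ℝ) → E} {l : Fin (n + 1)}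
    (hF : IsPeriodicIn l F) (k' : Fin n → ℝ) :
    Function.Periodic (fun s : ℝ => F (l.insertNth s k')) (2 * Real.pi) := fun s => by
  have h := hF (l.insertNth s k')
  simp only [Fin.insertNth_apply_same, update_insertNth_eq] at h
  exact h

/-- Shifts of a coordinate-periodic function are coordinate-periodic. [folklore] -/
theorem IsPeriodicIn.comp_shift {E : Type*} {F : (Fin (n + 1) → ℝ) → E} {l : Fin (n + 1)}
    (hF : IsPeriodicIn l F) (h : ℝ) : IsPeriodicIn l (fun k => F (shift l h k)) := fun k => by
  simp only [shift, Function.update_self, Function.update_idem]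
  have := hF (Function.update k l (k l + h))
  simp only [Function.update_self, Function.update_idem] at this
  rw [show k l + 2 * Real.pi + h = k l + h + 2 * Real.pi by ring]
  exact this

/-- Products of coordinate-periodic functions are coordinate-periodic. [folklore] -/
theorem IsPeriodicIn.mul {F G : (Fin (n + 1) → ℝ) → ℂ} {l : Fin (n + 1)}
    (hF : IsPeriodicIn l F) (hG : IsPeriodicIn l G) : IsPeriodicIn l (fun k => F k * G k) := fun k => by
  simp only [hF k, hG k]

/-- The (extended) norm of a coordinate-periodic function is coordinate-periodic. [folklore] -/
theorem IsPeriodicIn.norm {E : Type*} [NormedAddCommGroup E] {F : (Fin (n + 1) → ℝ) → E}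
    {l : Fin (n + 1)} (hF : IsPeriodicIn l F) : IsPeriodicIn l (fun k => (‖F k‖ₑ : ℝ≥0∞)) :=
  fun k => by simp only [hF k]

/-- The character `k ↦ e^{ik·x}` (`x ∈ ℤ^d`) is `2π`-periodic in every coordinate. [folklore] -/
theorem isPeriodicIn_cexp_kdot (l : Fin (n + 1)) (x : Site (n + 1)) :
    IsPeriodicIn l (fun k => Complex.exp (Complex.I * (kdot k x : ℂ))) := fun k => by
  show Complex.exp (Complex.I * (kdot (Function.update k l (k l + 2 * Real.pi)) x : ℂ)) =
    Complex.exp (Complex.I * (kdot k x : ℂ))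
  rw [kdot_update, show k l + 2 * Real.pi - k l = 2 * Real.pi by ring]
  push_cast
  rw [show Complex.I * ((kdot k x : ℂ) + 2 * (Real.pi : ℂ) * ((x l : ℤ) : ℂ)) =
      Complex.I * (kdot k x : ℂ) + ((x l : ℤ) : ℂ) * (2 * Real.pi * Complex.I) by ring,
    Complex.exp_add, Complex.exp_int_mul_two_pi_mul_I, mul_one]

/-- **Shift invariance on the cube (Bochner)**: for `Φ` `2π`-periodic in `k_l`, integrable on
`[-π,π]^d` together with its shift, `∫_{[-π,π]^d} Φ(k + h e_l) dk = ∫_{[-π,π]^d} Φ(k) dk` (Fubini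
in `k_l` and the invariance of the integral of a periodic function over a period). [folklore] -/
theorem setIntegral_cube_comp_shift {E : Type*} [NormedAddCommGroup E] [NormedSpace ℝ E]
    (l : Fin (n + 1)) {Φ : (Fin (n + 1) → ℝ) → E} (hper : IsPeriodicIn l Φ)
    (hΦ : IntegrableOn Φ (cube (n + 1))) (h : ℝ)
    (hΦh : IntegrableOn (fun k => Φ (shift l h k)) (cube (n + 1))) :
    ∫ k in cube (n + 1), Φ (shift l h k) = ∫ k in cube (n + 1), Φ k := by
  rw [integral_cube_succ_eq_iterated_of_integrable l hΦh, integral_cube_succ_eq_iterated_of_integrable l hΦ]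
  refine setIntegral_congr_fun (measurableSet_cube n) fun k' _ => ?_
  simp only [shift_insertNth]
  exact setIntegral_Icc_comp_add_of_periodic (hper.slice k') h

/-- The slicing equivalence restricted to the cube is measure preserving between
`([-π,π], ds) × ([-π,π]^n, dk')` and `([-π,π]^{n+1}, dk)`. [folklore] -/
theorem measurePreserving_insertNth_restrict (l : Fin (n + 1)) :
    MeasurePreserving (fun p : ℝ × (Fin n → ℝ) => (l.insertNth p.1 p.2 : Fin (n + 1) → ℝ))
      (((volume : Measure ℝ).restrict (Set.Icc (-Real.pi) Real.pi)).prod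
        ((volume : Measure (Fin n → ℝ)).restrict (cube n)))
      ((volume : Measure (Fin (n + 1) → ℝ)).restrict (cube (n + 1))) := by
  set e := MeasurableEquiv.piFinSuccAbove (fun _ : Fin (n + 1) => ℝ) l with he
  have hmp : MeasurePreserving e.symm volume volume :=
    (volume_preserving_piFinSuccAbove (fun _ : Fin (n + 1) => ℝ) l).symm
  have h := hmp.restrict_preimage_emb e.symm.measurableEmbedding (cube (n + 1))
  rw [piFinSuccAbove_symm_preimage_cube l, Measure.volume_eq_prod, ← Measure.prod_restrict] at h
  exact h

/-- **Tonelli on the cube along one coordinate**: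
`∫⁻_{[-π,π]^{n+1}} H = ∫⁻_{[-π,π]^n} ∫⁻_{[-π,π]} H(ins_l(s,k')) ds dk'` for `H ≥ 0` a.e.-measurable on
the cube. [folklore] -/
theorem setLIntegral_cube_succ_eq_iterated (l : Fin (n + 1)) {H : (Fin (n + 1) → ℝ) → ℝ≥0∞}
    (hH : AEMeasurable H ((volume : Measure (Fin (n + 1) → ℝ)).restrict (cube (n + 1)))) :
    ∫⁻ k in cube (n + 1), H k = ∫⁻ k' in cube n, ∫⁻ s in Set.Icc (-Real.pi) Real.pi, H (l.insertNth s k') := by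
  have hmp := measurePreserving_insertNth_restrict l
  have hemb : MeasurableEmbedding fun p : ℝ × (Fin n → ℝ) => (l.insertNth p.1 p.2 : Fin (n + 1) → ℝ) :=
    (MeasurableEquiv.piFinSuccAbove (fun _ : Fin (n + 1) => ℝ) l).symm.measurableEmbedding
  rw [← hmp.lintegral_comp_emb hemb,
    lintegral_prod_symm (fun p : ℝ × (Fin n → ℝ) => H (l.insertNth p.1 p.2))
      (hH.comp_quasiMeasurePreserving hmp.quasiMeasurePreserving)]

/-- **Shift invariance on the cube (Tonelli)**: for `Φ ≥ 0` `2π`-periodic in `k_l` (a.e.-measurable on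
the cube together with its shift), `∫⁻_{[-π,π]^d} Φ(k + h e_l) dk = ∫⁻_{[-π,π]^d} Φ(k) dk`. [folklore] -/
theorem setLIntegral_cube_comp_shift (l : Fin (n + 1)) {Φ : (Fin (n + 1) → ℝ) → ℝ≥0∞}
    (hper : IsPeriodicIn l Φ) (h : ℝ)
    (hΦm : AEMeasurable Φ ((volume : Measure (Fin (n + 1) → ℝ)).restrict (cube (n + 1))))
    (hΦhm : AEMeasurable (fun k => Φ (shift l h k)) ((volume : Measure (Fin (n + 1) → ℝ)).restrict (cube (n + 1)))) :
    ∫⁻ k in cube (n + 1), Φ (shift l h k) = ∫⁻ k in cube (n + 1), Φ k := by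
  rw [setLIntegral_cube_succ_eq_iterated l hΦhm, setLIntegral_cube_succ_eq_iterated l hΦm]
  refine setLIntegral_congr_fun (measurableSet_cube n) fun k' _ => ?_
  simp only [shift_insertNth]
  exact setLIntegral_Icc_comp_add_of_periodic (hper.slice k') h

/-- Integrability transfers to shifts of a periodic function (the `L¹` norms over the cube agree),
given the a.e.-strong measurability of the shift on the cube. [folklore] -/
theorem IsPeriodicIn.integrableOn_comp_shift {E : Type*} [NormedAddCommGroup E] {l : Fin (n + 1)}
    {Φ : (Fin (n + 1) → ℝ) → E} (hper : IsPeriodicIn l Φ) (hΦ : IntegrableOn Φ (cube (n + 1))) {h : ℝ}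
    (hΦhm : AEStronglyMeasurable (fun k => Φ (shift l h k))
      ((volume : Measure (Fin (n + 1) → ℝ)).restrict (cube (n + 1)))) :
    IntegrableOn (fun k => Φ (shift l h k)) (cube (n + 1)) := by
  refine ⟨hΦhm, ?_⟩
  have h1 := setLIntegral_cube_comp_shift l hper.norm h hΦ.1.enorm hΦhm.enorm
  rw [HasFiniteIntegral, h1]
  exact hΦ.2

/-! ### A shift by `h e_l` multiplies Fourier coefficients by `e^{-ihx_l}` -/

/-- **`∫_{[-π,π]^d} e^{ik·x} F(k + h e_l) dk = e^{-ihx_l} ∫_{[-π,π]^d} e^{ik·x} F(k) dk`** for `F`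
`2π`-periodic in `k_l`, integrable on the cube together with its shift, and `x ∈ ℤ^d`. [folklore] -/
theorem setIntegral_cube_cexp_mul_shift (l : Fin (n + 1)) {F : (Fin (n + 1) → ℝ) → ℂ}
    (hper : IsPeriodicIn l F) (hF : IntegrableOn F (cube (n + 1))) {h : ℝ}
    (hFh : IntegrableOn (fun k => F (shift l h k)) (cube (n + 1))) (x : Site (n + 1)) :
    ∫ k in cube (n + 1), Complex.exp (Complex.I * (kdot k x : ℂ)) * F (shift l h k) =
      Complex.exp (-(Complex.I * h * ((x l : ℤ) : ℂ))) *
        ∫ k in cube (n + 1), Complex.exp (Complex.I * (kdot k x : ℂ)) * F k := by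
  set Ψ : (Fin (n + 1) → ℝ) → ℂ := fun k => Complex.exp (Complex.I * (kdot k x : ℂ)) * F k with hΨ
  have hΨper : IsPeriodicIn l Ψ := (isPeriodicIn_cexp_kdot l x).mul hper
  have hΨi : IntegrableOn Ψ (cube (n + 1)) := integrableOn_cexp_kdot_mul hF x
  -- the integrand is `e^{-ihx_l} Ψ(k + h e_l)`
  have hpt : ∀ k, Complex.exp (Complex.I * (kdot k x : ℂ)) * F (shift l h k) =
      Complex.exp (-(Complex.I * h * ((x l : ℤ) : ℂ))) * Ψ (shift l h k) := by
    intro k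
    simp only [hΨ, kdot_shift]
    push_cast
    rw [← mul_assoc, ← Complex.exp_add]
    congr 2
    ring
  have hΨhi : IntegrableOn (fun k => Ψ (shift l h k)) (cube (n + 1)) := by
    have : (fun k => Ψ (shift l h k)) = fun k => Complex.exp (Complex.I * h * ((x l : ℤ) : ℂ)) *
        (Complex.exp (Complex.I * (kdot k x : ℂ)) * F (shift l h k)) := by
      funext k
      rw [hpt k, ← mul_assoc, ← Complex.exp_add, add_neg_cancel, Complex.exp_zero, one_mul]
    rw [this]
    exact (integrableOn_cexp_kdot_mul hFh x).const_mul _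
  simp_rw [hpt]
  rw [integral_const_mul, setIntegral_cube_comp_shift l hΨper hΨi h hΨhi]

/-! ### Second differences and the dyadic smear -/

/-- The symmetric second difference `F(k) - ½(F(k + h e_l) + F(k - h e_l))`. [folklore] -/
def sdiff (F : (Fin (n + 1) → ℝ) → ℂ) (l : Fin (n + 1)) (h : ℝ) (k : Fin (n + 1) → ℝ) : ℂ :=
  F k - (F (shift l h k) + F (shift l (-h) k)) / 2

/-- **Fourier coefficients of a second difference**:
`∫ e^{ik·x} [F(k) - ½F(k + he_l) - ½F(k - he_l)] dk = (1 - cos(h x_l)) ∫ e^{ik·x} F(k) dk`. [folklore] -/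
theorem setIntegral_cube_cexp_mul_sdiff (l : Fin (n + 1)) {F : (Fin (n + 1) → ℝ) → ℂ}
    (hper : IsPeriodicIn l F) (hF : IntegrableOn F (cube (n + 1))) {h : ℝ}
    (hFp : IntegrableOn (fun k => F (shift l h k)) (cube (n + 1)))
    (hFm : IntegrableOn (fun k => F (shift l (-h) k)) (cube (n + 1))) (x : Site (n + 1)) :
    ∫ k in cube (n + 1), Complex.exp (Complex.I * (kdot k x : ℂ)) * sdiff F l h k =
      ((1 - Real.cos (h * ((x l : ℤ) : ℝ)) : ℝ) : ℂ) *
        ∫ k in cube (n + 1), Complex.exp (Complex.I * (kdot k x : ℂ)) * F k := by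
  have hi0 := integrableOn_cexp_kdot_mul hF x
  have hip := integrableOn_cexp_kdot_mul hFp x
  have him := integrableOn_cexp_kdot_mul hFm x
  have e1 : (fun k => Complex.exp (Complex.I * (kdot k x : ℂ)) * sdiff F l h k) = fun k =>
      Complex.exp (Complex.I * (kdot k x : ℂ)) * F k -
        (Complex.exp (Complex.I * (kdot k x : ℂ)) * F (shift l h k) +
          Complex.exp (Complex.I * (kdot k x : ℂ)) * F (shift l (-h) k)) / 2 := by
    funext k; simp only [sdiff]; ring
  have hsum2 : Integrable (fun k => (Complex.exp (Complex.I * (kdot k x : ℂ)) * F (shift l h k) +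
      Complex.exp (Complex.I * (kdot k x : ℂ)) * F (shift l (-h) k)) / 2)
      ((volume : Measure (Fin (n + 1) → ℝ)).restrict (cube (n + 1))) := (hip.add him).div_const 2
  rw [e1, integral_sub hi0 hsum2, integral_div, integral_add hip him,
    setIntegral_cube_cexp_mul_shift l hper hF hFp x, setIntegral_cube_cexp_mul_shift l hper hF hFm x]
  set I := ∫ k in cube (n + 1), Complex.exp (Complex.I * (kdot k x : ℂ)) * F k
  have e2 : Complex.exp (-(Complex.I * (h : ℂ) * ((x l : ℤ) : ℂ))) =
      Complex.exp (-((h : ℂ) * ((x l : ℤ) : ℂ)) * Complex.I) := by congr 1; ring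
  have e3 : Complex.exp (-(Complex.I * ((-h : ℝ) : ℂ) * ((x l : ℤ) : ℂ))) =
      Complex.exp (((h : ℂ) * ((x l : ℤ) : ℂ)) * Complex.I) := by congr 1; push_cast; ring
  rw [e2, e3]
  push_cast
  simp only [Complex.cos]
  ring

/-- The dyadic smear `T_θ F = Σ_n 2^{nθ} [F - ½F(· + h_n e_l) - ½F(· - h_n e_l)]`. [folklore] -/
def smear (θ : ℝ) (l : Fin (n + 1)) (F : (Fin (n + 1) → ℝ) → ℂ) (k : Fin (n + 1) → ℝ) : ℂ :=
  ∑' m : ℕ, (((2 : ℝ) ^ ((m : ℝ) * θ) : ℝ) : ℂ) * sdiff F l (step m) k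

/-- **The Fourier representative of `w_θ(x_l) f(x)`.** If `F` represents `f`
(`f(x) = ∫ e^{ik·x} F dk/(2π)^d`), `F` is `2π`-periodic in `k_l`, its shifts by `±h_n e_l` are
a.e.-strongly measurable on the cube and `Σ_n 2^{nθ} ∫_{[-π,π]^d} ‖Δ²_{h_n} F‖ < ∞`, then the
dyadic smear `T_θ F` represents `x ↦ w_θ(x_l) f(x)`. [folklore] -/
theorem _root_.Literature.Barriers.CriticalPhenomena.IsFourierPair.fracWeight_mul
    {θ : ℝ} (l : Fin (n + 1)) {f : Site (n + 1) → ℝ}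
    {F : (Fin (n + 1) → ℝ) → ℂ} (hfF : IsFourierPair f F) (hper : IsPeriodicIn l F)
    (hmeas : ∀ h : ℝ, AEStronglyMeasurable (fun k => F (shift l h k))
      ((volume : Measure (Fin (n + 1) → ℝ)).restrict (cube (n + 1))))
    (hsum : ∑' m : ℕ, ENNReal.ofReal ((2 : ℝ) ^ ((m : ℝ) * θ)) *
      ∫⁻ k in cube (n + 1), ‖sdiff F l (step m) k‖ₑ ≠ ⊤) :
    IsFourierPair (fun x => fracWeight θ ((x l : ℤ) : ℝ) * f x) (smear θ l F) := by
  have hF : IntegrableOn F (cube (n + 1)) := hfF.integrableOn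
  have hFs : ∀ h, IntegrableOn (fun k => F (shift l h k)) (cube (n + 1)) := fun h =>
    hper.integrableOn_comp_shift hF (hmeas h)
  -- the terms of the smear and their `L¹` bounds
  set g : ℕ → (Fin (n + 1) → ℝ) → ℂ := fun m k => (((2 : ℝ) ^ ((m : ℝ) * θ) : ℝ) : ℂ) * sdiff F l (step m) k
    with hg
  have hsd : ∀ m, IntegrableOn (sdiff F l (step m)) (cube (n + 1)) := fun m =>
    (hF.sub (((hFs _).add (hFs _)).div_const 2))
  have hgi : ∀ m, IntegrableOn (g m) (cube (n + 1)) := fun m => (hsd m).const_mul _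
  have hgnorm : ∀ m k, ‖g m k‖ₑ = ENNReal.ofReal ((2 : ℝ) ^ ((m : ℝ) * θ)) * ‖sdiff F l (step m) k‖ₑ := by
    intro m k
    rw [hg, enorm_mul, ← ofReal_norm (((2 : ℝ) ^ ((m : ℝ) * θ) : ℝ) : ℂ), Complex.norm_real,
      Real.norm_of_nonneg (Real.rpow_nonneg (by norm_num) _)]
  have hsum' : ∑' m, ∫⁻ k in cube (n + 1), ‖g m k‖ₑ ≠ ⊤ := by
    have : ∀ m, ∫⁻ k in cube (n + 1), ‖g m k‖ₑ =
        ENNReal.ofReal ((2 : ℝ) ^ ((m : ℝ) * θ)) * ∫⁻ k in cube (n + 1), ‖sdiff F l (step m) k‖ₑ := by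
      intro m
      simp_rw [hgnorm m]
      rw [lintegral_const_mul'' _ (hsd m).1.enorm]
    simp_rw [this]
    exact hsum
  obtain ⟨hint, -⟩ := integrable_tsum_of_lintegral (μ := volume.restrict (cube (n + 1)))
    (fun m => (hgi m).1) hsum'
  refine ⟨hint, fun x => ?_⟩
  -- the character times the smear, summed term by term
  have hchar : ∀ m, IntegrableOn (fun k => Complex.exp (Complex.I * (kdot k x : ℂ)) * g m k) (cube (n + 1)) :=
    fun m => integrableOn_cexp_kdot_mul (hgi m) x
  have hsumx : ∑' m, ∫⁻ k in cube (n + 1), ‖Complex.exp (Complex.I * (kdot k x : ℂ)) * g m k‖ₑ ≠ ⊤ := by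
    have : ∀ m k, ‖Complex.exp (Complex.I * (kdot k x : ℂ)) * g m k‖ₑ = ‖g m k‖ₑ := by
      intro m k
      rw [enorm_mul, ← ofReal_norm (Complex.exp _), norm_cexp_I_mul_kdot, ENNReal.ofReal_one, one_mul]
    simp_rw [this]
    exact hsum'
  have hswap : ∫ k in cube (n + 1), Complex.exp (Complex.I * (kdot k x : ℂ)) * smear θ l F k =
      ∑' m, ∫ k in cube (n + 1), Complex.exp (Complex.I * (kdot k x : ℂ)) * g m k := by
    simp only [smear, ← tsum_mul_left]
    exact integral_tsum (fun m => (hchar m).1) hsumx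
  -- each term: `(1 - cos(h_m x_l)) 2^{mθ} (2π)^d f(x)`
  have hterm : ∀ m, ∫ k in cube (n + 1), Complex.exp (Complex.I * (kdot k x : ℂ)) * g m k =
      ((term θ m ((x l : ℤ) : ℝ) : ℝ) : ℂ) * ((2 * Real.pi : ℂ) ^ (n + 1) * (f x : ℂ)) := by
    intro m
    have h1 : (fun k => Complex.exp (Complex.I * (kdot k x : ℂ)) * g m k) = fun k =>
        (((2 : ℝ) ^ ((m : ℝ) * θ) : ℝ) : ℂ) * (Complex.exp (Complex.I * (kdot k x : ℂ)) * sdiff F l (step m) k) := by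
      funext k; simp only [hg]; ring
    rw [h1, integral_const_mul, setIntegral_cube_cexp_mul_sdiff l hper hF (hFs _) (hFs _) x]
    have hrepr := hfF.repr x
    have h2π : ((2 * Real.pi : ℂ)) ^ (n + 1) ≠ 0 := pow_ne_zero _ (by exact_mod_cast Real.two_pi_pos.ne')
    rw [eq_div_iff h2π] at hrepr
    rw [← hrepr, term]
    push_cast
    ring
  simp_rw [hswap, hterm]
  rw [tsum_mul_right]
  have hw : ∑' m, ((term θ m ((x l : ℤ) : ℝ) : ℝ) : ℂ) = ((fracWeight θ ((x l : ℤ) : ℝ) : ℝ) : ℂ) := by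
    rw [← Complex.ofReal_tsum]; rfl
  rw [hw]
  have h2π : ((2 * Real.pi : ℂ)) ^ (n + 1) ≠ 0 := pow_ne_zero _ (by exact_mod_cast Real.two_pi_pos.ne')
  field_simp
  push_cast
  ring

end FracSmear

end Literature.Barriers.CriticalPhenomena
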